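import Literature.Barriers.Schanuel.EFunctionValuesAtAlgebraicPointsSeries
import Literature.Barriers.Schanuel.EFunctionValuesAtAlgebraicPointsEGF
import Literature.Barriers.Schanuel.EFunctionValuesAtAlgebraicPointsWeights
import Literature.Barriers.Schanuel.EFunctionValuesAtAlgebraicPointsAsymptotics
import HarnessLib

/-!
# Barrier (Schanuel) `EFunctionValuesAtAlgebraicPoints`: the analytic estimate of Baker's Lemma 4 (`|∑ qᵢⱼ Eᵢ(α)|` small) — proofs only

`Literature/Barriers/Schanuel/EFunctionValuesAtAlgebraicPointsAnalytic.lean` — sibling file of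
`EFunctionValuesAtAlgebraicPoints.lean` in the programme to discharge `siegelShidlovskii_algIndep`
(Siegel–Shidlovskii; Rivoal Thm. 5.10 = Baker Thm. 11.1). The complex-analytic half of Baker,
*Transcendental Number Theory*, Ch. 11, Lemma 4 (p. 112, estimate (5): "`|Φ^{(h)}(α)| <
r! ∑_{m ≥ M} (m!)^ε ((m−h)!)^{-1} |α|^{m−h}` … `≤ h! c₇ᴹ (M!)^{-1+ε}`"), organised as a direct
estimate of the value at `σ₀(α)` of the entire function attached to a form:

* `SiegelShidlovskii.expBound_embedding` — `E`-function data read in `ℂ` through an embedding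
  `σ₀ : K →+* ℂ` have geometrically bounded coefficients (`‖σ₀ x‖ ≤ house x`);
* `SiegelShidlovskii.formFun σ₀ a q z = ∑ᵢ (σ₀qᵢ)(z) · Fᵢ(z)` with `Fᵢ = eSeries (σ₀ ∘ aᵢ)`, an
  entire function whose Taylor series is `σ₀(∑ᵢ qᵢ · egf aᵢ)` (`taylorPS_formFun`) and whose
  value at `σ₀ α` is `∑ᵢ σ₀(qᵢ(α)) Fᵢ(σ₀α)` (`formFun_apply_embedding`);
* `SiegelShidlovskii.norm_embedding_coeff_form_le` — `‖σ₀ [X^N](∑ qᵢ egf aᵢ)‖ ≤ ν W C (C+1)^N/N!`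
  from the factorial weights `W` of the `qᵢ` and `house aᵢ(m) ≤ C^{m+1}`;
* `SiegelShidlovskii.norm_formFun_le` — if the form vanishes at `0` to order `≥ L` then
  `‖formFun (σ₀ α)‖ ≤ ν W C · (x^L/L!) eˣ`, `x = (C+1)‖σ₀α‖`.

All [folklore]; no named facts.

## References

* A. Baker, *Transcendental Number Theory*, CUP 1975, Ch. 11 §3, proof of Lemma 4 (p. 112).
-/

noncomputable section

open Polynomial NumberField
open scoped Nat

namespace Literature.Barriers.Schanuel

namespace SiegelShidlovskii

variable {K : Type*} [Field K] [NumberField K] (σ₀ : K →+* ℂ)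

/-! ### 1. Coefficients read in `ℂ` -/

/-- The two binomial convolutions agree on `ℂ` (EGF file vs. Series file). [folklore] -/
theorem bconv_eq_binomConv (a b : ℕ → ℂ) : bconv a b = binomConv a b := rfl

/-- `‖σ₀ x‖ ≤ house x ≤ C^{m+1}`: the complex coefficients are geometrically bounded. [folklore] -/
theorem expBound_embedding (a : ℕ → K) {C : ℝ} (hC : 0 ≤ C) (h : ∀ m, house (a m) ≤ C ^ (m + 1)) :
    ExpBound (σ₀ ∘ a) := by
  refine ⟨C, C, hC, hC, fun m => ?_⟩
  calc ‖(σ₀ ∘ a) m‖ = ‖σ₀ (a m)‖ := rfl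
    _ ≤ house (a m) := norm_embedding_le_house _ _
    _ ≤ C ^ (m + 1) := h m
    _ = C * C ^ m := by ring

/-! ### 2. The entire function attached to a form -/

section FormFun

variable {ν : ℕ} (a : Fin ν → ℕ → K) (q : Fin ν → K[X])

/-- `Φ_q(z) = ∑ᵢ (σ₀ qᵢ)(z) · Fᵢ(z)`, `Fᵢ = eSeries (σ₀ ∘ aᵢ)` (Baker's `∑ P_{ij}(x) Eᵢ(x)` read
in `ℂ`). [folklore] -/
def formFun (z : ℂ) : ℂ :=
  ∑ i, ((q i).map σ₀).eval z * eSeries (σ₀ ∘ a i) z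

omit [NumberField K] in
/-- `Φ_q` is entire. [folklore] -/
theorem differentiable_formFun (ha : ∀ i, ExpBound (σ₀ ∘ a i)) :
    Differentiable ℂ (formFun σ₀ a q) := by
  unfold formFun
  refine Differentiable.fun_sum fun i _ => ?_
  exact ((q i).map σ₀).differentiable.mul (differentiable_eSeries (ha i))

/-- Taylor series of finite sums of entire functions. [folklore] -/
theorem taylorPS_sum {ι : Type*} (s : Finset ι) (g : ι → ℂ → ℂ) (hg : ∀ i ∈ s, Differentiable ℂ (g i)) :
    taylorPS (fun z => ∑ i ∈ s, g i z) = ∑ i ∈ s, taylorPS (g i) := by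
  classical
  induction s using Finset.induction_on with
  | empty =>
    ext n
    simp [taylorPS]
  | insert i s hi ih =>
    have hgi : Differentiable ℂ (g i) := hg i (Finset.mem_insert_self _ _)
    have hgs : ∀ j ∈ s, Differentiable ℂ (g j) := fun j hj => hg j (Finset.mem_insert_of_mem hj)
    have hsum : Differentiable ℂ (fun z => ∑ j ∈ s, g j z) := Differentiable.fun_sum fun j hj => hgs j hj
    rw [Finset.sum_insert hi, ← ih hgs]
    have : (fun z => ∑ j ∈ insert i s, g j z) = g i + fun z => ∑ j ∈ s, g j z := by
      funext z; rw [Finset.sum_insert hi]; rfl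
    rw [this, taylorPS_add hgi hsum]

omit [NumberField K] in
/-- **Taylor series of `Φ_q`** is the form read in `ℂ`:
`taylorPS Φ_q = σ₀ (∑ᵢ qᵢ · egf aᵢ)`. [folklore] -/
theorem taylorPS_formFun (ha : ∀ i, ExpBound (σ₀ ∘ a i)) :
    taylorPS (formFun σ₀ a q) =
      PowerSeries.map σ₀ (form (coeAlgHom K) (fun i => egf (a i)) q) := by
  unfold formFun
  rw [taylorPS_sum Finset.univ (fun i z => ((q i).map σ₀).eval z * eSeries (σ₀ ∘ a i) z)
    fun i _ => ((q i).map σ₀).differentiable.mul (differentiable_eSeries (ha i))]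
  simp only [form, map_sum, map_mul, coeAlgHom_apply]
  refine Finset.sum_congr rfl fun i _ => ?_
  rw [show (fun z => ((q i).map σ₀).eval z * eSeries (σ₀ ∘ a i) z) =
      (fun z => ((q i).map σ₀).eval z) * eSeries (σ₀ ∘ a i) from rfl,
    taylorPS_mul ((q i).map σ₀).differentiable (differentiable_eSeries (ha i)),
    taylorPS_polynomial, taylorPS_eSeries (ha i), Polynomial.polynomial_map_coe, map_egf]
  rfl

omit [NumberField K] in
/-- The value at `σ₀ α`: `Φ_q(σ₀α) = ∑ᵢ σ₀(qᵢ(α)) Fᵢ(σ₀α)`. [folklore] -/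
theorem formFun_apply_embedding (α : K) :
    formFun σ₀ a q (σ₀ α) = ∑ i, σ₀ ((q i).eval α) * eSeries (σ₀ ∘ a i) (σ₀ α) := by
  unfold formFun
  refine Finset.sum_congr rfl fun i _ => ?_
  rw [eval_map, eval₂_hom]

/-- An entire function is the sum of its Taylor series: `Φ(z) = ∑ [Xᴺ](taylorPS Φ) · zᴺ`.
[folklore] -/
theorem hasSum_taylorPS {Φ : ℂ → ℂ} (hΦ : Differentiable ℂ Φ) (z : ℂ) :
    HasSum (fun N => PowerSeries.coeff N (taylorPS Φ) * z ^ N) (Φ z) := by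
  have h := Complex.hasSum_taylorSeries_of_entire hΦ 0 z
  have heq : (fun n => ((n ! : ℂ))⁻¹ • (z - 0) ^ n • iteratedDeriv n Φ 0) =
      fun N => PowerSeries.coeff N (taylorPS Φ) * z ^ N := by
    funext N
    rw [coeff_taylorPS, sub_zero, smul_eq_mul, smul_eq_mul]
    ring
  rw [heq] at h
  exact h

end FormFun

/-! ### 3. The coefficient bound -/

section Bounds

variable {ν : ℕ} {a : Fin ν → ℕ → K} {q : Fin ν → K[X]} {W C : ℝ}

/-- **`‖σ₀ [Xᴺ](∑ qᵢ egf aᵢ)‖ ≤ ν W C (C+1)ᴺ / N!`** from the factorial weights of the `qᵢ` and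
`house aᵢ(m) ≤ C^{m+1}` (`∑ₛ C(N,s) C^{N−s} = (C+1)ᴺ`). [folklore] -/
theorem norm_embedding_coeff_form_le (hq : ∀ i, FactWtLE (q i) W)
    (ha : ∀ i m, house (a i m) ≤ C ^ (m + 1)) (N : ℕ) :
    ‖σ₀ (PowerSeries.coeff N (form (coeAlgHom K) (fun i => egf (a i)) q))‖ ≤
      ν * W * C * (C + 1) ^ N / (N ! : ℝ) := by
  rcases Nat.eq_zero_or_pos ν with hν | hν
  · subst hν
    -- no functions: the coefficient is `0`, and the bound reads `0 ≤ 0`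
    simp [form]
  have hW : 0 ≤ W := (hq ⟨0, hν⟩).nonneg
  have hNf : (0 : ℝ) < (N ! : ℝ) := by exact_mod_cast Nat.factorial_pos N
  rw [le_div_iff₀ hNf]
  have hfac := factorial_mul_coeff_form_egf q a N
  have hnorm : ‖σ₀ (PowerSeries.coeff N (form (coeAlgHom K) (fun i => egf (a i)) q))‖ * (N ! : ℝ) =
      ‖σ₀ ((N ! : K) * PowerSeries.coeff N (form (coeAlgHom K) (fun i => egf (a i)) q))‖ := by
    rw [map_mul, norm_mul, map_natCast, Complex.norm_natCast, mul_comm]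
  rw [hnorm, hfac, map_sum]
  calc ‖∑ i, σ₀ (∑ s ∈ Finset.range (N + 1),
          (N.choose s : K) * ((s ! : K) * (q i).coeff s * a i (N - s)))‖
      ≤ ∑ i, ‖σ₀ (∑ s ∈ Finset.range (N + 1),
          (N.choose s : K) * ((s ! : K) * (q i).coeff s * a i (N - s)))‖ := norm_sum_le _ _
    _ ≤ ∑ _i : Fin ν, W * C * (C + 1) ^ N := by
        refine Finset.sum_le_sum fun i _ => ?_
        rw [map_sum]
        calc ‖∑ s ∈ Finset.range (N + 1), σ₀ ((N.choose s : K) * ((s ! : K) * (q i).coeff s * a i (N - s)))‖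
            ≤ ∑ s ∈ Finset.range (N + 1), (N.choose s : ℝ) * (W * C ^ (N - s + 1)) := by
              refine norm_sum_le_of_le _ fun s _ => ?_
              rw [map_mul, map_mul, norm_mul, norm_mul, map_natCast, Complex.norm_natCast]
              refine mul_le_mul_of_nonneg_left ?_ (Nat.cast_nonneg _)
              exact mul_le_mul ((norm_embedding_le_house _ _).trans (hq i s))
                ((norm_embedding_le_house _ _).trans (ha i _)) (norm_nonneg _) hW
          _ = W * C * ∑ s ∈ Finset.range (N + 1), (1 : ℝ) ^ s * C ^ (N - s) * (N.choose s : ℝ) := by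
              rw [Finset.mul_sum]
              refine Finset.sum_congr rfl fun s _ => ?_
              rw [pow_succ]; ring
          _ = W * C * (C + 1) ^ N := by rw [← add_pow, add_comm]
    _ = ν * W * C * (C + 1) ^ N := by
        rw [Finset.sum_const, Finset.card_univ, Fintype.card_fin, nsmul_eq_mul]
        ring

/-- **The value of `Φ_q` at `σ₀ α` is small** (Baker's (5)): if `∑ qᵢ egf aᵢ` vanishes to order
`≥ L` at `0`, then `‖Φ_q(σ₀ α)‖ ≤ ν W C · (xᴸ/L!) eˣ`, `x = (C+1) ‖σ₀ α‖`. [folklore] -/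
theorem norm_formFun_le (hq : ∀ i, FactWtLE (q i) W) (hC : 0 ≤ C)
    (ha : ∀ i m, house (a i m) ≤ C ^ (m + 1)) {L : ℕ}
    (hL : (L : ℕ∞) ≤ (form (coeAlgHom K) (fun i => egf (a i)) q).order) (α : K) :
    ‖formFun σ₀ a q (σ₀ α)‖ ≤
      ν * W * C * (((C + 1) * ‖σ₀ α‖) ^ L / (L ! : ℝ) * Real.exp ((C + 1) * ‖σ₀ α‖)) := by
  have hexp : ∀ i, ExpBound (σ₀ ∘ a i) := fun i => expBound_embedding σ₀ (a i) hC (ha i)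
  set x : ℝ := (C + 1) * ‖σ₀ α‖ with hx
  have hx0 : 0 ≤ x := by positivity
  have hW : 0 ≤ ν * W * C := by
    rcases Nat.eq_zero_or_pos ν with h | h
    · subst h; simp
    · have := (hq ⟨0, h⟩).nonneg; positivity
  -- the Taylor expansion at `σ₀ α`
  have hsum := hasSum_taylorPS (differentiable_formFun σ₀ a q hexp) (σ₀ α)
  rw [taylorPS_formFun σ₀ a q hexp] at hsum
  -- the majorant `g N = ν W C x^N/N!` for `N ≥ L`, `0` below
  set g : ℕ → ℝ := fun N => if L ≤ N then ν * W * C * (x ^ N / (N ! : ℝ)) else 0 with hg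
  have hgsum : HasSum g (ν * W * C * ∑' k : ℕ, x ^ (L + k) / ((L + k)! : ℝ)) := by
    have h1 : HasSum (fun k : ℕ => ν * W * C * (x ^ (L + k) / ((L + k)! : ℝ)))
        (ν * W * C * ∑' k : ℕ, x ^ (L + k) / ((L + k)! : ℝ)) :=
      (summable_pow_div_factorial_add x L).hasSum.mul_left _
    rw [← hasSum_nat_add_iff' L]
    have hzero : ∑ i ∈ Finset.range L, g i = 0 :=
      Finset.sum_eq_zero fun i hi => by simp [hg, not_le.mpr (Finset.mem_range.mp hi)]
    rw [hzero, sub_zero]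
    have heq : (fun i => g (i + L)) = fun k : ℕ => ν * W * C * (x ^ (L + k) / ((L + k)! : ℝ)) := by
      funext k
      simp [hg, add_comm k L]
    rw [heq]
    exact h1
  have hbound : ∀ N, ‖σ₀ (PowerSeries.coeff N (form (coeAlgHom K) (fun i => egf (a i)) q)) *
      σ₀ α ^ N‖ ≤ g N := by
    intro N
    by_cases hN : L ≤ N
    · simp only [hg, if_pos hN]
      rw [norm_mul, norm_pow]
      calc ‖σ₀ (PowerSeries.coeff N (form (coeAlgHom K) (fun i => egf (a i)) q))‖ * ‖σ₀ α‖ ^ N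
          ≤ (ν * W * C * (C + 1) ^ N / (N ! : ℝ)) * ‖σ₀ α‖ ^ N :=
            mul_le_mul_of_nonneg_right (norm_embedding_coeff_form_le σ₀ hq ha N) (by positivity)
        _ = ν * W * C * (x ^ N / (N ! : ℝ)) := by rw [hx, mul_pow]; ring
    · have hcoeff : PowerSeries.coeff N (form (coeAlgHom K) (fun i => egf (a i)) q) = 0 :=
        PowerSeries.coeff_of_lt_order N (lt_of_lt_of_le (by exact_mod_cast not_le.mp hN) hL)
      rw [hcoeff, map_zero, zero_mul, norm_zero, hg]
      simp [hN]
  refine (hsum.norm_le_of_bounded hgsum hbound).trans ?_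
  exact mul_le_mul_of_nonneg_left (tsum_tail_exp_le hx0 L) hW

end Bounds

end SiegelShidlovskii

end Literature.Barriers.Schanuel

end
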